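import Literature.Geometry.Lorentzian.NormalisedNullRayCausal
import Literature.Geometry.Lorentzian.EventHorizon
import Literature.Geometry.Lorentzian.CauchyHypersurfaceGlobalHyperbolicity
import Summits.FinalStateConjecture.FinalStateConjecture.Statement
import HarnessLib

/-!
# Helpers for stub `stub_settledExteriorHoldsRays` of line `Sketch` of crux `HonestFixedRadiusSettlingT`
# (stmt-FinalStateConjecture-17575): the free causal bookkeeping of the ray clause, and the terminal
# reduction isolating its load-bearing sub-claim

The registered stub `stub_settledExteriorHoldsRays : Theses.TangentConeAtIPlus.SettledExteriorHoldsRays`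
is LITERALLY ledger item stmt-FinalStateConjecture-17673 (crux r6 of route TangentConeAtIPlus, shared
with RaychaudhuriBlowdown; 2026-08-17: open, unclaimed, no evidence, no landed proof or refutation).
Per development `𝒟` and charted late region `U = fd.charted` its conclusion is
`RaysStayInClosure 𝒟 (exteriorOf 𝒟 U)`: every point `γ t`, `t ≥ 0`, of every future-COMPLETE
normalised null ray `γ` from the data lies in `closure (J⁺(ι X) ∩ I⁻(U))`.

## Diagnosis (which half is free, which sub-claim is load-bearing)

* FREE, already in the tree: `γ t ∈ J⁺(ι X)` for `t ≥ 0`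
  (`LorentzianMetric.IsNormalisedNullRayFrom.mem_causalFuture_range`, `NormalisedNullRayCausal.lean`:
  the future-null velocity propagates along the geodesic, so `γ|[0, t]` is a future causal curve).
* FREE, proved here: (a) a ray point in `I⁻(U)` with `t ≥ 0` lies in `exteriorOf 𝒟 U` itself
  (`ray_mem_exteriorOf_of_mem_chronologicalPast`); (b) the parameters `t` with `γ t ∈ I⁻(U)` form a
  DOWN-set of the affine domain (`ray_mem_chronologicalPast_of_le`, push-up `J⁻(I⁻ U) = I⁻ U`), so
  a ray that has left `I⁻(U)` never re-enters it (`ray_not_mem_chronologicalPast_of_le`); (c) hence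
  `RaysStayInClosure 𝒟 (exteriorOf 𝒟 U)` is EQUIVALENT to its restriction to the terminal ray points
  outside `I⁻(U)` (`raysStayInClosure_exteriorOf_iff_terminal`), equivalently, at set level,
  `completeNullRayRegion 𝒟 \ I⁻(U) ⊆ closure (exteriorOf 𝒟 U)`
  (`raysStayInClosure_exteriorOf_iff_diff_subset`; `raysStayInClosure_iff_completeNullRayRegion_subset`
  rewrites the clause as `completeNullRayRegion ⊆ closure O` in the vocabulary of `EventHorizon.lean`,
  and `raysStayInClosure_iff_disjoint` as "the complete-ray region misses `J⁺(ι X) \ closure O`", the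
  planner's `NoCompleteRayInside`).
* LOAD-BEARING and NOT provable in the tree: the terminal sub-claim itself — for a future-complete
  normalised ray (`IsNormalisedNullRayFrom … p γ dom`, `¬ BddAbove dom`) and a parameter `t ≥ 0` with
  `γ t ∉ 𝒟.metric.chronologicalPast 𝒟.timeOrientation fd.charted` (so `γ t' ∉ I⁻(charted)` for
  all later `t'`), `γ t ∈ closure (exteriorOf 𝒟 fd.charted)`. Physically: (i) a complete ray from
  `Σ` cannot end up in the black-hole interior `J⁺(ι X) ∖ closure O` (interior incompleteness — in
  the tree only for exact sub-extremal Kerr, `KerrBlackHoleNoCompleteNullRay_holds`; for a general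
  MGHD no named fact exists, and `HasCompleteNullInfinity` (sojourn form), `IsMaximal`,
  `HasExhaustiveCharts fd`, `IsFutureOriented fd` say nothing about rays that never signal to
  `fd.charted`), and (ii) complete horizon generators (`γ t ∈ ∂I⁻(charted)`) are limits of `O`.
  The refuter's hidden-bag mechanism (a second future-complete region behind a neck of `X = M # N`,
  `Cruxes/ChannelsResolveTameDevelopmentsR/Disproof.lean` §8.2) attacks exactly (i); it is not
  constructible in the tree either (no `IsMaximal` development of any datum is).

No definitions, no named facts, no `sorry`; this module does not import any `Theses` file, so the
eventual closing file of item 17673 can import it.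
-/

set_option linter.dupNamespace false

noncomputable section

open scoped Manifold ContDiff Topology
open Filter Set Function Literature.Geometry.Lorentzian

namespace Summit.FinalStateConjecture.FinalStateConjecture.Theorems.StarvedNecks.SettledRays

variable {X : Type} [TopologicalSpace X] [ChartedSpace E3 X] [IsManifold (𝓡 3) ∞ X]
  [ConnectedSpace X] {D : InitialDataSet (𝓡 3) X}

/-- **A ray point that can signal to the charted region lies in the exterior itself**: if `γ` is a
normalised null ray from the data of the Cauchy development `𝒟`, `t ≥ 0` is a parameter of its
affine domain and `γ t ∈ I⁻(U)`, then `γ t ∈ exteriorOf 𝒟 U = J⁺(ι X) ∩ I⁻(U)` — the `J⁺(ι X)`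
half is `IsNormalisedNullRayFrom.mem_causalFuture_range` (O'Neill 1983, Ch. 14, p. 402).
[cite: ONeillSemiRiemannian1983, Ch. 14, p. 402] -/
theorem ray_mem_exteriorOf_of_mem_chronologicalPast (𝒟 : CauchyDevelopment D)
    [𝒟.metric.HasLeviCivita] (U : Set 𝒟.carrier) {p : X} {γ : ℝ → 𝒟.carrier} {dom : Set ℝ}
    (hγ : 𝒟.metric.IsNormalisedNullRayFrom 𝒟.timeOrientation 𝒟.embed 𝒟.normal p γ dom)
    {t : ℝ} (ht : t ∈ dom) (ht0 : 0 ≤ t)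
    (hU : γ t ∈ 𝒟.metric.chronologicalPast 𝒟.timeOrientation U) :
    γ t ∈ exteriorOf 𝒟 U :=
  ⟨hγ.mem_causalFuture_range ht ht0, hU⟩

/-- **Later ray points lie in the causal future of earlier ones**: for parameters `t₁ ≤ t₂` of the
affine domain of a normalised null ray `γ`, `γ t₂ ∈ J⁺(γ t₁)` (the ray is a future causal curve on
its domain, `IsNormalisedNullRayFrom.isFutureCausalCurveOn`, and the domain is an interval).
[cite: ONeillSemiRiemannian1983, Ch. 14, p. 402] -/
theorem ray_mem_causalFuture_of_le (𝒟 : CauchyDevelopment D) [𝒟.metric.HasLeviCivita]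
    {p : X} {γ : ℝ → 𝒟.carrier} {dom : Set ℝ}
    (hγ : 𝒟.metric.IsNormalisedNullRayFrom 𝒟.timeOrientation 𝒟.embed 𝒟.normal p γ dom)
    {t₁ t₂ : ℝ} (ht₁ : t₁ ∈ dom) (ht₂ : t₂ ∈ dom) (h₁₂ : t₁ ≤ t₂) :
    γ t₂ ∈ 𝒟.metric.causalFuture 𝒟.timeOrientation {γ t₁} := by
  rcases h₁₂.eq_or_lt with rfl | hlt
  · exact LorentzianMetric.subset_causalFuture _ _ _ (mem_singleton _)
  · exact Or.inr ⟨γ t₁, mem_singleton _, γ, t₁, t₂, hlt,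
      hγ.isFutureCausalCurveOn.mono (hγ.isMaximalGeodesicOn.2.1.out ht₁ ht₂), rfl, rfl⟩

/-- **The parameters at which a ray can signal to `U` form a down-set**: if `γ t₂ ∈ I⁻(U)` and
`t₁ ≤ t₂` (both in the affine domain) then `γ t₁ ∈ I⁻(U)` — push-up read towards the past,
`J⁻(I⁻(U)) = I⁻(U)` (O'Neill 1983, Ch. 14, Cor. 14.1), applied to `γ t₂ ∈ J⁺(γ t₁)`.
[cite: ONeillSemiRiemannian1983, Ch. 14, Cor. 14.1 (p. 402)] -/
theorem ray_mem_chronologicalPast_of_le (𝒟 : CauchyDevelopment D) [𝒟.metric.HasLeviCivita]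
    (U : Set 𝒟.carrier) {p : X} {γ : ℝ → 𝒟.carrier} {dom : Set ℝ}
    (hγ : 𝒟.metric.IsNormalisedNullRayFrom 𝒟.timeOrientation 𝒟.embed 𝒟.normal p γ dom)
    {t₁ t₂ : ℝ} (ht₁ : t₁ ∈ dom) (ht₂ : t₂ ∈ dom) (h₁₂ : t₁ ≤ t₂)
    (hU : γ t₂ ∈ 𝒟.metric.chronologicalPast 𝒟.timeOrientation U) :
    γ t₁ ∈ 𝒟.metric.chronologicalPast 𝒟.timeOrientation U :=
  LorentzianMetric.mem_chronologicalPast_of_mem_causalFuture_of_mem_chronologicalPast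
    (WithTop.coe_le_coe.2 le_top) (ray_mem_causalFuture_of_le 𝒟 hγ ht₁ ht₂ h₁₂) hU

/-- **A ray that has left `I⁻(U)` never re-enters it**: if `γ t₁ ∉ I⁻(U)` then `γ t₂ ∉ I⁻(U)` for
every later parameter `t₂ ≥ t₁` of the affine domain (contrapositive of the down-set property).
[cite: ONeillSemiRiemannian1983, Ch. 14, Cor. 14.1 (p. 402)] -/
theorem ray_not_mem_chronologicalPast_of_le (𝒟 : CauchyDevelopment D) [𝒟.metric.HasLeviCivita]
    (U : Set 𝒟.carrier) {p : X} {γ : ℝ → 𝒟.carrier} {dom : Set ℝ}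
    (hγ : 𝒟.metric.IsNormalisedNullRayFrom 𝒟.timeOrientation 𝒟.embed 𝒟.normal p γ dom)
    {t₁ t₂ : ℝ} (ht₁ : t₁ ∈ dom) (ht₂ : t₂ ∈ dom) (h₁₂ : t₁ ≤ t₂)
    (hU : γ t₁ ∉ 𝒟.metric.chronologicalPast 𝒟.timeOrientation U) :
    γ t₂ ∉ 𝒟.metric.chronologicalPast 𝒟.timeOrientation U :=
  fun h ↦ hU (ray_mem_chronologicalPast_of_le 𝒟 U hγ ht₁ ht₂ h₁₂ h)

/-- **Terminal reduction of the ray clause for an honest exterior.** `RaysStayInClosure 𝒟 (exteriorOf 𝒟 U)`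
holds as soon as it holds at the ray points OUTSIDE `I⁻(U)`: a point `γ t`, `t ≥ 0`, with
`γ t ∈ I⁻(U)` lies in `exteriorOf 𝒟 U` itself (`ray_mem_exteriorOf_of_mem_chronologicalPast`). By
`ray_not_mem_chronologicalPast_of_le` the hypothesis concerns a terminal segment of each complete ray:
this is the load-bearing sub-claim of item stmt-FinalStateConjecture-17673 (no complete ray from the
data ends up in `J⁺(ι X) ∖ closure O`; complete horizon generators are limits of `O`). Registered
helper stub of stmt-FinalStateConjecture-17575 (closed one-line signature).
[cite: ONeillSemiRiemannian1983, Ch. 14, p. 402] -/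
theorem raysStayInClosure_exteriorOf_of_terminal : ∀ {X : Type} [TopologicalSpace X] [ChartedSpace E3 X] [IsManifold (𝓡 3) ∞ X] [ConnectedSpace X] {D : InitialDataSet (𝓡 3) X} (𝒟 : CauchyDevelopment D) (U : Set 𝒟.carrier), (∀ [𝒟.metric.HasLeviCivita], ∀ (p : X) (γ : ℝ → 𝒟.carrier) (dom : Set ℝ), 𝒟.metric.IsNormalisedNullRayFrom 𝒟.timeOrientation 𝒟.embed 𝒟.normal p γ dom → ¬ BddAbove dom → ∀ t ∈ dom, 0 ≤ t → γ t ∉ 𝒟.metric.chronologicalPast 𝒟.timeOrientation U → γ t ∈ closure (Summit.FinalStateConjecture.exteriorOf 𝒟 U)) → Summit.FinalStateConjecture.RaysStayInClosure 𝒟 (Summit.FinalStateConjecture.exteriorOf 𝒟 U) := by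
  intro X _ _ _ _ D 𝒟 U h _ p γ dom hγ hdom t ht ht0
  by_cases hU : γ t ∈ 𝒟.metric.chronologicalPast 𝒟.timeOrientation U
  · exact subset_closure (ray_mem_exteriorOf_of_mem_chronologicalPast 𝒟 U hγ ht ht0 hU)
  · exact h p γ dom hγ hdom t ht ht0 hU

/-- **The ray clause for an honest exterior is equivalent to its terminal form**: only the points of
future-complete rays that cannot signal to the charted region `U` carry content.
[cite: ONeillSemiRiemannian1983, Ch. 14, p. 402] -/
theorem raysStayInClosure_exteriorOf_iff_terminal (𝒟 : CauchyDevelopment D) (U : Set 𝒟.carrier) :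
    RaysStayInClosure 𝒟 (exteriorOf 𝒟 U) ↔
      ∀ [𝒟.metric.HasLeviCivita], ∀ (p : X) (γ : ℝ → 𝒟.carrier) (dom : Set ℝ),
        𝒟.metric.IsNormalisedNullRayFrom 𝒟.timeOrientation 𝒟.embed 𝒟.normal p γ dom →
          ¬ BddAbove dom → ∀ t ∈ dom, 0 ≤ t →
            γ t ∉ 𝒟.metric.chronologicalPast 𝒟.timeOrientation U →
              γ t ∈ closure (exteriorOf 𝒟 U) :=
  ⟨fun h _ p γ dom hγ hdom t ht ht0 _ ↦ h p γ dom hγ hdom t ht ht0,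
    raysStayInClosure_exteriorOf_of_terminal 𝒟 U⟩

/-- **The ray clause in the vocabulary of `EventHorizon.lean`**: `RaysStayInClosure 𝒟 O` says exactly
that the complete-ray region of `𝒟` (the union of the nonnegative halves of all future-complete
normalised rays from the data, the intrinsic stand-in for a neighbourhood of `𝓘⁺`) lies in
`closure O`. [cite: arXiv08110354, §2.5.4] -/
theorem raysStayInClosure_iff_completeNullRayRegion_subset (𝒟 : CauchyDevelopment D)
    (O : Set 𝒟.carrier) :
    RaysStayInClosure 𝒟 O ↔ ∀ [𝒟.metric.HasLeviCivita], 𝒟.completeNullRayRegion ⊆ closure O := by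
  constructor
  · intro h _ q hq
    obtain ⟨p, δ, s, t, hδ, hs, ht, ht0, rfl⟩ := LorentzianMetric.mem_completeNullRayRegion_iff.1 hq
    exact h p δ s hδ hs t ht ht0
  · intro h _ p γ dom hγ hdom t ht ht0
    exact h (LorentzianMetric.image_subset_completeNullRayRegion hγ hdom ⟨t, ⟨ht, ht0⟩, rfl⟩)

/-- **"No complete ray inside the black-hole region."** For any region `O`, the ray clause
`RaysStayInClosure 𝒟 O` is equivalent to the complete-ray region missing `J⁺(ι X) \ closure O` — the
black-hole region relative to `O` of the rationale of item stmt-FinalStateConjecture-17673 — because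
complete-ray points lie in `J⁺(ι X)` anyway (`LorentzianMetric.completeNullRayRegion_subset_causalFuture`).
Registered helper stub of stmt-FinalStateConjecture-17575 (closed one-line signature).
[cite: arXiv08110354, §2.5.4] -/
theorem raysStayInClosure_iff_disjoint : ∀ {X : Type} [TopologicalSpace X] [ChartedSpace E3 X] [IsManifold (𝓡 3) ∞ X] [ConnectedSpace X] {D : InitialDataSet (𝓡 3) X} (𝒟 : CauchyDevelopment D) (O : Set 𝒟.carrier), Summit.FinalStateConjecture.RaysStayInClosure 𝒟 O ↔ ∀ [𝒟.metric.HasLeviCivita], Disjoint 𝒟.completeNullRayRegion (𝒟.metric.causalFuture 𝒟.timeOrientation (Set.range 𝒟.embed) \ closure O) := by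
  intro X _ _ _ _ D 𝒟 O
  rw [raysStayInClosure_iff_completeNullRayRegion_subset]
  constructor
  · intro h _
    exact disjoint_left.2 fun q hq hB ↦ hB.2 (h hq)
  · intro h _ q hq
    by_contra hc
    exact disjoint_left.1 h hq
      ⟨LorentzianMetric.completeNullRayRegion_subset_causalFuture _ _ _ _ hq, hc⟩

/-- **Set-level terminal form**: for an honest exterior `O = exteriorOf 𝒟 U` the ray clause says that
the part of the complete-ray region which cannot signal to `U` lies in `closure O` (the part which
can is inside `O`). [cite: arXiv08110354, §2.5.4] -/
theorem raysStayInClosure_exteriorOf_iff_diff_subset (𝒟 : CauchyDevelopment D) (U : Set 𝒟.carrier) :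
    RaysStayInClosure 𝒟 (exteriorOf 𝒟 U) ↔
      ∀ [𝒟.metric.HasLeviCivita],
        𝒟.completeNullRayRegion \ 𝒟.metric.chronologicalPast 𝒟.timeOrientation U ⊆
          closure (exteriorOf 𝒟 U) := by
  rw [raysStayInClosure_exteriorOf_iff_terminal]
  constructor
  · intro h _ q hq
    obtain ⟨p, δ, s, t, hδ, hs, ht, ht0, rfl⟩ :=
      LorentzianMetric.mem_completeNullRayRegion_iff.1 hq.1
    exact h p δ s hδ hs t ht ht0 hq.2
  · intro h _ p γ dom hγ hdom t ht ht0 hU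
    exact h ⟨LorentzianMetric.image_subset_completeNullRayRegion hγ hdom ⟨t, ⟨ht, ht0⟩, rfl⟩, hU⟩

/-- **Inside `I⁻(U)` the complete-ray region is part of the exterior**: the free half of the ray
clause at set level, `completeNullRayRegion ∩ I⁻(U) ⊆ exteriorOf 𝒟 U`.
[cite: ONeillSemiRiemannian1983, Ch. 14, p. 402] -/
theorem completeNullRayRegion_inter_chronologicalPast_subset_exteriorOf (𝒟 : CauchyDevelopment D)
    [𝒟.metric.HasLeviCivita] (U : Set 𝒟.carrier) :
    𝒟.completeNullRayRegion ∩ 𝒟.metric.chronologicalPast 𝒟.timeOrientation U ⊆ exteriorOf 𝒟 U := by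
  rintro q ⟨hq, hU⟩
  obtain ⟨p, δ, s, t, hδ, hs, ht, ht0, rfl⟩ := LorentzianMetric.mem_completeNullRayRegion_iff.1 hq
  exact ray_mem_exteriorOf_of_mem_chronologicalPast 𝒟 U hδ ht ht0 hU

end Summit.FinalStateConjecture.FinalStateConjecture.Theorems.StarvedNecks.SettledRays

end
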